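import Summits.AtomisticToContinuum.HydrodynamicLimit.Theorems.CollisionIsometryCLTCollisionalTransferLocalityFluxForm
import Summits.AtomisticToContinuum.HydrodynamicLimit.Theorems.CollisionIsometryCLTCollisionalTransferLocalityAffineSlaving
import HarnessLib

/-!
# Audit lemmas for stub [A'-chaos]° `stub_fluxFormChaosE`, part 1: linearity in the tests
(line hemisphere-affine-slaving, crux `CollisionalTransferLocality`, stmt-AtomisticToContinuum-9518, v8)

Sorry-free bookkeeping facts found during the adversarial audit of the RE-KEYED research stub
`stub_fluxFormChaosE` (`FluxFormChaos σ a₀ θ₀ u₀ Φ φ t ψ χ`: `M_N − Sraw_N → 0` in local-Gibbs probability,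
uniformly in `τ ≤ t`; stub worker W-A of the lead prover-line-stmt-AtomisticToContinuum-9518-c4-0, census
`work/stubs/stub_fluxFormChaosE.census.md`, evidence on the item). The stub itself is NOT proved here
(research-level: a non-equilibrium mesoscopic Campbell law for the marked collision process). This file:
LINEARITY IN THE TESTS. `markK`, `chaosNum`/`chaosAvg`/`rawK` and hence `Mfun`, `Sraw` are ADDITIVE and
HOMOGENEOUS in the pair `(ψ, χ)` at smooth slices (`markK_add`, `rawK_add`, `Mfun_add`, `Sraw_add`, `…_smul`; the
gradients `gradPsi`, `gradChi` are additive on `C¹` slices, the sphere-side numerator has the closed form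
`sphNum_eq` = `integral_sphere_inner_sq_mul`, the block pair law is a finite double sum), so the set of smooth test
pairs satisfying `FluxFormChaos σ a₀ θ₀ u₀ Φ φ t · ·` is a LINEAR SUBSPACE up to the null bad set:
`fluxFormChaos_add` (registered helper), `fluxFormChaos_smul`, and the stub reduces to the two pure cases `(ψ, 0)`
and `(0, χ)` (`fluxFormChaos_of_split`) — the two Hoeffding projections `ω⊗ω` and `(V·ω)ω` decouple in the
statement (union bound, `localGibbsLaw_compl_good'`). Part 2 (`…FluxFormChaosEDomination`): `|M_N| ≤ 6 C₁ V_N`,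
tightness of `M_N` under [V], of `Sraw_N` under [V] + the stub, and the degenerate keying `E₀ < 0`.
-/

namespace Summit.AtomisticToContinuum.HydrodynamicLimit.Theorems.HemisphereAffineSlaving

open scoped BigOperators Topology Classical ENNReal InnerProductSpace
open Filter Set Function MeasureTheory
open Literature.Analysis.FunctionSpaces Literature.Analysis.FluidPDE

noncomputable section

open Literature.MathematicalPhysics.KineticTheory (T3 V3 hsDiameter hsDiameter_pos localGibbsLaw tendsto_hsDiameter)

/-! ## 1. Linearity of the gradient data of the tests on smooth slices -/

section Linearity

/-- `∇(f + g) = ∇f + ∇g` for `C¹` scalars on `𝕋³`. [folklore] -/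
private theorem gradient_add' {f g : T3 → ℝ} (hf : Torus.IsContDiff 1 f) (hg : Torus.IsContDiff 1 g)
    (x : T3) : Torus.gradient (f + g) x = Torus.gradient f x + Torus.gradient g x := by
  refine ext_inner_right ℝ fun w => ?_
  rw [Torus.inner_gradient_left, inner_add_left, Torus.inner_gradient_left, Torus.inner_gradient_left,
    Torus.fderiv_add hf hg]
  rfl

/-- `∇(c f) = c ∇f` for `C¹` scalars on `𝕋³`. [folklore] -/
private theorem gradient_smul' {f : T3 → ℝ} (hf : Torus.IsContDiff 1 f) (c : ℝ) (x : T3) :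
    Torus.gradient (c • f) x = c • Torus.gradient f x := by
  refine ext_inner_right ℝ fun w => ?_
  rw [Torus.inner_gradient_left, real_inner_smul_left, Torus.inner_gradient_left,
    Torus.fderiv_const_smul hf c]
  rfl

variable {ψ ψ₁ ψ₂ : ℝ → T3 → V3} {χ χ₁ χ₂ : ℝ → T3 → ℝ} {s : ℝ}

/-- `∇(ψ₁ + ψ₂) = ∇ψ₁ + ∇ψ₂` componentwise at a smooth slice. [folklore] -/
theorem gradPsi_add (h₁ : Torus.IsSmooth (ψ₁ s)) (h₂ : Torus.IsSmooth (ψ₂ s)) (x : T3) (a b : Fin 3) :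
    gradPsi (ψ₁ + ψ₂) s x a b = gradPsi ψ₁ s x a b + gradPsi ψ₂ s x a b := by
  have e : (fun y => (ψ₁ + ψ₂) s y a) = (fun y => ψ₁ s y a) + fun y => ψ₂ s y a := rfl
  simp only [gradPsi]
  rw [e, gradient_add' ((h₁.apply a).isContDiff (by simp)) ((h₂.apply a).isContDiff (by simp)),
    PiLp.add_apply]

/-- `∇(χ₁ + χ₂) = ∇χ₁ + ∇χ₂` at a smooth slice. [folklore] -/
theorem gradChi_add (h₁ : Torus.IsSmooth (χ₁ s)) (h₂ : Torus.IsSmooth (χ₂ s)) (x : T3) :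
    gradChi (χ₁ + χ₂) s x = gradChi χ₁ s x + gradChi χ₂ s x := by
  simp only [gradChi]
  exact gradient_add' (h₁.isContDiff (by simp)) (h₂.isContDiff (by simp)) x

/-- `∇(c ψ) = c ∇ψ` componentwise at a smooth slice. [folklore] -/
theorem gradPsi_smul (h : Torus.IsSmooth (ψ s)) (c : ℝ) (x : T3) (a b : Fin 3) :
    gradPsi (c • ψ) s x a b = c * gradPsi ψ s x a b := by
  have e : (fun y => (c • ψ) s y a) = c • fun y => ψ s y a := by
    funext y; simp [Pi.smul_apply, PiLp.smul_apply, smul_eq_mul]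
  simp only [gradPsi]
  rw [e, gradient_smul' ((h.apply a).isContDiff (by simp)), PiLp.smul_apply, smul_eq_mul]

/-- `∇(c χ) = c ∇χ` at a smooth slice. [folklore] -/
theorem gradChi_smul (h : Torus.IsSmooth (χ s)) (c : ℝ) (x : T3) :
    gradChi (c • χ) s x = c • gradChi χ s x := by
  simp only [gradChi]
  exact gradient_smul' (h.isContDiff (by simp)) c x

/-! ## 2. Linearity of the mark kernel, the chaos average and the two collision sums -/

/-- The flux-form mark kernel is additive in the test pair at smooth slices. [folklore] -/
theorem markK_add (hψ₁ : Torus.IsSmooth (ψ₁ s)) (hψ₂ : Torus.IsSmooth (ψ₂ s)) (hχ₁ : Torus.IsSmooth (χ₁ s))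
    (hχ₂ : Torus.IsSmooth (χ₂ s)) (σ : ℝ) (N : ℕ) (w : Cfg N) (i j : Fin (N + 1)) :
    markK σ (ψ₁ + ψ₂) (χ₁ + χ₂) N s w i j = markK σ ψ₁ χ₁ N s w i j + markK σ ψ₂ χ₂ N s w i j := by
  simp only [markK, gradPsi_add hψ₁ hψ₂, gradChi_add hχ₁ hχ₂, PiLp.add_apply, mul_add,
    Finset.sum_add_distrib]
  ring

/-- The flux-form mark kernel is homogeneous in the test pair at smooth slices. [folklore] -/
theorem markK_smul (hψ : Torus.IsSmooth (ψ s)) (hχ : Torus.IsSmooth (χ s)) (c σ : ℝ) (N : ℕ) (w : Cfg N)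
    (i j : Fin (N + 1)) :
    markK σ (c • ψ) (c • χ) N s w i j = c * markK σ ψ χ N s w i j := by
  have h1 : ∑ a, ∑ b, omg N w i j a * omg N w i j b * gradPsi (c • ψ) s (w i).1 a b =
      c * ∑ a, ∑ b, omg N w i j a * omg N w i j b * gradPsi ψ s (w i).1 a b := by
    rw [Finset.mul_sum]
    refine Finset.sum_congr rfl fun a _ => ?_
    rw [Finset.mul_sum]
    refine Finset.sum_congr rfl fun b _ => ?_
    rw [gradPsi_smul hψ]
    ring
  have h2 : ∑ a, omg N w i j a * gradChi (c • χ) s (w i).1 a = c * ∑ a, omg N w i j a * gradChi χ s (w i).1 a := by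
    rw [Finset.mul_sum]
    refine Finset.sum_congr rfl fun a _ => ?_
    rw [gradChi_smul hχ, PiLp.smul_apply, smul_eq_mul]
    ring
  rw [markK, markK, h1, h2]
  ring

/-- **Closed form of the sphere-side numerator** (the two flux moments of the lever,
`integral_sphere_inner_sq_mul`): with `g = v − v'`, `V = (v + v')/2`, `G = ∇ψ(s,x)`, `e = ∇χ(s,x)`,
`sphNum = (4π/15)[‖g‖²(tr G + ⟪V,e⟫) + 2 g⊗g:G + 2⟪g,V⟫⟪g,e⟫]` — a polynomial, LINEAR in `(G, e)`. [folklore] -/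
theorem sphNum_eq (ψ : ℝ → T3 → V3) (χ : ℝ → T3 → ℝ) (s : ℝ) (x : T3) (v v' : V3) :
    sphNum ψ χ s x v v' = 4 * Real.pi / 15 * (‖v - v'‖ ^ 2 * ((∑ a, gradPsi ψ s x a a) +
        inner ℝ ((1 / 2 : ℝ) • (v + v')) (gradChi χ s x)) +
      2 * (∑ a, ∑ b, (v - v') a * (v - v') b * gradPsi ψ s x a b) +
      2 * (inner ℝ (v - v') ((1 / 2 : ℝ) • (v + v')) * inner ℝ (v - v') (gradChi χ s x))) :=
  integral_sphere_inner_sq_mul (v - v') ((1 / 2 : ℝ) • (v + v')) (gradChi χ s x) (gradPsi ψ s x)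

/-- The sphere-side numerator is additive in the test pair at smooth slices. [folklore] -/
theorem sphNum_add (hψ₁ : Torus.IsSmooth (ψ₁ s)) (hψ₂ : Torus.IsSmooth (ψ₂ s)) (hχ₁ : Torus.IsSmooth (χ₁ s))
    (hχ₂ : Torus.IsSmooth (χ₂ s)) (x : T3) (v v' : V3) :
    sphNum (ψ₁ + ψ₂) (χ₁ + χ₂) s x v v' = sphNum ψ₁ χ₁ s x v v' + sphNum ψ₂ χ₂ s x v v' := by
  rw [sphNum_eq, sphNum_eq, sphNum_eq]
  simp only [gradPsi_add hψ₁ hψ₂, gradChi_add hχ₁ hχ₂, inner_add_right, Finset.sum_add_distrib, mul_add]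
  ring

/-- The sphere-side numerator is homogeneous in the test pair at smooth slices. [folklore] -/
theorem sphNum_smul (hψ : Torus.IsSmooth (ψ s)) (hχ : Torus.IsSmooth (χ s)) (c : ℝ) (x : T3) (v v' : V3) :
    sphNum (c • ψ) (c • χ) s x v v' = c * sphNum ψ χ s x v v' := by
  have h1 : ∑ a, gradPsi (c • ψ) s x a a = c * ∑ a, gradPsi ψ s x a a := by
    rw [Finset.mul_sum]
    exact Finset.sum_congr rfl fun a _ => gradPsi_smul hψ c x a a
  have h2 : ∑ a, ∑ b, (v - v') a * (v - v') b * gradPsi (c • ψ) s x a b =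
      c * ∑ a, ∑ b, (v - v') a * (v - v') b * gradPsi ψ s x a b := by
    rw [Finset.mul_sum]
    refine Finset.sum_congr rfl fun a _ => ?_
    rw [Finset.mul_sum]
    refine Finset.sum_congr rfl fun b _ => ?_
    rw [gradPsi_smul hψ]
    ring
  rw [sphNum_eq, sphNum_eq, h1, h2, gradChi_smul hχ]
  simp only [inner_smul_right]
  ring

/-- The chaos average is additive in the test pair at smooth slices (the block flux normaliser
`chaosDen` does not see the tests; junk `0/0 = 0` on degenerate blocks on both sides). [folklore] -/
theorem chaosAvg_add (hψ₁ : Torus.IsSmooth (ψ₁ s)) (hψ₂ : Torus.IsSmooth (ψ₂ s)) (hχ₁ : Torus.IsSmooth (χ₁ s))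
    (hχ₂ : Torus.IsSmooth (χ₂ s)) (φ : ℕ → T3 → ℝ) (N : ℕ) (w : Cfg N) (x : T3) :
    chaosAvg (ψ₁ + ψ₂) (χ₁ + χ₂) φ N s w x = chaosAvg ψ₁ χ₁ φ N s w x + chaosAvg ψ₂ χ₂ φ N s w x := by
  have hnum : chaosNum (ψ₁ + ψ₂) (χ₁ + χ₂) φ N s w x = chaosNum ψ₁ χ₁ φ N s w x + chaosNum ψ₂ χ₂ φ N s w x := by
    simp only [chaosNum, integral_empiricalMeasure, sphNum_add hψ₁ hψ₂ hχ₁ hχ₂, mul_add,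
      Finset.sum_add_distrib]
  rw [chaosAvg, chaosAvg, chaosAvg, hnum, add_div]

/-- The chaos average is homogeneous in the test pair at smooth slices. [folklore] -/
theorem chaosAvg_smul (hψ : Torus.IsSmooth (ψ s)) (hχ : Torus.IsSmooth (χ s)) (c : ℝ) (φ : ℕ → T3 → ℝ) (N : ℕ)
    (w : Cfg N) (x : T3) :
    chaosAvg (c • ψ) (c • χ) φ N s w x = c * chaosAvg ψ χ φ N s w x := by
  have hnum : chaosNum (c • ψ) (c • χ) φ N s w x = c * chaosNum ψ χ φ N s w x := by
    simp only [chaosNum, integral_empiricalMeasure, sphNum_smul hψ hχ, Finset.mul_sum]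
    exact Finset.sum_congr rfl fun i _ => Finset.sum_congr rfl fun j _ => by ring
  rw [chaosAvg, chaosAvg, hnum, mul_div_assoc]

/-- The raw chaos kernel is additive in the test pair at smooth slices. [folklore] -/
theorem rawK_add (hψ₁ : Torus.IsSmooth (ψ₁ s)) (hψ₂ : Torus.IsSmooth (ψ₂ s)) (hχ₁ : Torus.IsSmooth (χ₁ s))
    (hχ₂ : Torus.IsSmooth (χ₂ s)) (σ : ℝ) (φ : ℕ → T3 → ℝ) (N : ℕ) (w : Cfg N) (i j : Fin (N + 1)) :
    rawK σ (ψ₁ + ψ₂) (χ₁ + χ₂) φ N s w i j = rawK σ ψ₁ χ₁ φ N s w i j + rawK σ ψ₂ χ₂ φ N s w i j := by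
  simp only [rawK, chaosAvg_add hψ₁ hψ₂ hχ₁ hχ₂, mul_add]

/-- The raw chaos kernel is homogeneous in the test pair at smooth slices. [folklore] -/
theorem rawK_smul (hψ : Torus.IsSmooth (ψ s)) (hχ : Torus.IsSmooth (χ s)) (c σ : ℝ) (φ : ℕ → T3 → ℝ) (N : ℕ)
    (w : Cfg N) (i j : Fin (N + 1)) :
    rawK σ (c • ψ) (c • χ) φ N s w i j = c * rawK σ ψ χ φ N s w i j := by
  simp only [rawK, chaosAvg_smul hψ hχ]
  ring

variable {σ : ℝ} (Φ : Flows σ) {N : ℕ} {z : Cfg N} {τ : ℝ}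

/-- A collision pair sum along a good orbit over `(0, τ]` only sees the kernel at collision times in
`(0, τ]`: pointwise-equal kernels there give equal sums. [folklore] -/
private theorem cps_congr (hz : z ∈ (Φ N).good) {g g' : ℝ → Cfg N → Fin (N + 1) → Fin (N + 1) → ℝ}
    (h : ∀ s ∈ Ioc 0 τ, ∀ w i j, g s w i j = g' s w i j) :
    (Φ N).collisionPairSum (Ioc 0 τ) g z = (Φ N).collisionPairSum (Ioc 0 τ) g' z := by
  have hfin := ((Φ N).isTrajectory z hz).finite_collisionTimes_inter_Ioc 0 τ
  unfold HardSphereFlow.collisionPairSum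
  rw [collisionPairSum_eq_finset_sum hfin, collisionPairSum_eq_finset_sum hfin]
  refine Finset.sum_congr rfl fun tc htc => Finset.sum_congr rfl fun p _ => ?_
  exact h tc ((Set.Finite.mem_toFinset hfin).1 htc).2 _ p.1 p.2

/-- A collision pair sum along a good orbit is additive in the kernel. [folklore] -/
private theorem cps_add (hz : z ∈ (Φ N).good) (g g' : ℝ → Cfg N → Fin (N + 1) → Fin (N + 1) → ℝ) :
    (Φ N).collisionPairSum (Ioc 0 τ) (fun s w i j => g s w i j + g' s w i j) z =
      (Φ N).collisionPairSum (Ioc 0 τ) g z + (Φ N).collisionPairSum (Ioc 0 τ) g' z := by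
  have hfin := ((Φ N).isTrajectory z hz).finite_collisionTimes_inter_Ioc 0 τ
  unfold HardSphereFlow.collisionPairSum
  exact collisionPairSum_add hfin _ _

/-- Constants come out of a collision pair sum along a good orbit. [folklore] -/
private theorem cps_const_mul (hz : z ∈ (Φ N).good) (c : ℝ) (g : ℝ → Cfg N → Fin (N + 1) → Fin (N + 1) → ℝ) :
    (Φ N).collisionPairSum (Ioc 0 τ) (fun s w i j => c * g s w i j) z =
      c * (Φ N).collisionPairSum (Ioc 0 τ) g z := by
  have hfin := ((Φ N).isTrajectory z hz).finite_collisionTimes_inter_Ioc 0 τ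
  unfold HardSphereFlow.collisionPairSum
  exact collisionPairSum_const_mul hfin _ _

/-- **`M_N` is additive in the test pair** on the good set, for tests with smooth slices on `(0, τ]`. [folklore] -/
theorem Mfun_add (hz : z ∈ (Φ N).good) (hψ₁ : ∀ s ∈ Ioc 0 τ, Torus.IsSmooth (ψ₁ s))
    (hψ₂ : ∀ s ∈ Ioc 0 τ, Torus.IsSmooth (ψ₂ s)) (hχ₁ : ∀ s ∈ Ioc 0 τ, Torus.IsSmooth (χ₁ s))
    (hχ₂ : ∀ s ∈ Ioc 0 τ, Torus.IsSmooth (χ₂ s)) :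
    Mfun σ Φ (ψ₁ + ψ₂) (χ₁ + χ₂) N z τ = Mfun σ Φ ψ₁ χ₁ N z τ + Mfun σ Φ ψ₂ χ₂ N z τ := by
  unfold Mfun
  rw [← mul_add, ← cps_add Φ hz]
  congr 1
  exact cps_congr Φ hz fun s hs w i j => markK_add (hψ₁ s hs) (hψ₂ s hs) (hχ₁ s hs) (hχ₂ s hs) σ N w i j

/-- **`Sraw_N` is additive in the test pair** on the good set, for tests with smooth slices on `(0, τ]`. [folklore] -/
theorem Sraw_add (hz : z ∈ (Φ N).good) (hψ₁ : ∀ s ∈ Ioc 0 τ, Torus.IsSmooth (ψ₁ s))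
    (hψ₂ : ∀ s ∈ Ioc 0 τ, Torus.IsSmooth (ψ₂ s)) (hχ₁ : ∀ s ∈ Ioc 0 τ, Torus.IsSmooth (χ₁ s))
    (hχ₂ : ∀ s ∈ Ioc 0 τ, Torus.IsSmooth (χ₂ s)) (φ : ℕ → T3 → ℝ) :
    Sraw σ Φ φ (ψ₁ + ψ₂) (χ₁ + χ₂) N z τ = Sraw σ Φ φ ψ₁ χ₁ N z τ + Sraw σ Φ φ ψ₂ χ₂ N z τ := by
  unfold Sraw
  rw [← mul_add, ← cps_add Φ hz]
  congr 1
  exact cps_congr Φ hz fun s hs w i j => rawK_add (hψ₁ s hs) (hψ₂ s hs) (hχ₁ s hs) (hχ₂ s hs) σ φ N w i j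

/-- `M_N` is homogeneous in the test pair on the good set. [folklore] -/
theorem Mfun_smul (hz : z ∈ (Φ N).good) (hψ : ∀ s ∈ Ioc 0 τ, Torus.IsSmooth (ψ s))
    (hχ : ∀ s ∈ Ioc 0 τ, Torus.IsSmooth (χ s)) (c : ℝ) :
    Mfun σ Φ (c • ψ) (c • χ) N z τ = c * Mfun σ Φ ψ χ N z τ := by
  unfold Mfun
  rw [cps_congr Φ hz (g := markK σ (c • ψ) (c • χ) N) (g' := fun s w i j => c * markK σ ψ χ N s w i j)
    (fun s hs w i j => markK_smul (hψ s hs) (hχ s hs) c σ N w i j), cps_const_mul Φ hz c (markK σ ψ χ N)]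
  ring

/-- `Sraw_N` is homogeneous in the test pair on the good set. [folklore] -/
theorem Sraw_smul (hz : z ∈ (Φ N).good) (hψ : ∀ s ∈ Ioc 0 τ, Torus.IsSmooth (ψ s))
    (hχ : ∀ s ∈ Ioc 0 τ, Torus.IsSmooth (χ s)) (c : ℝ) (φ : ℕ → T3 → ℝ) :
    Sraw σ Φ φ (c • ψ) (c • χ) N z τ = c * Sraw σ Φ φ ψ χ N z τ := by
  unfold Sraw
  rw [cps_congr Φ hz (g := rawK σ (c • ψ) (c • χ) φ N) (g' := fun s w i j => c * rawK σ ψ χ φ N s w i j)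
    (fun s hs w i j => rawK_smul (hψ s hs) (hχ s hs) c σ φ N w i j), cps_const_mul Φ hz c (rawK σ ψ χ φ N)]
  ring

end Linearity

/-! ## 3. `FluxFormChaos` is a linear condition on the smooth test pairs -/

section FluxFormChaosLinear

variable {σ : ℝ} {a₀ θ₀ : T3 → ℝ} {u₀ : T3 → V3} {Φ : Flows σ} {φ : ℕ → T3 → ℝ} {t : ℝ}
  {ψ ψ₁ ψ₂ : ℝ → T3 → V3} {χ χ₁ χ₂ : ℝ → T3 → ℝ}

/-- **[A'-chaos] is ADDITIVE in the test pair.** If `FluxFormChaos` holds at `(ψ₁, χ₁)` and at `(ψ₂, χ₂)`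
(all four jointly smooth on `[0, t]`), it holds at `(ψ₁ + ψ₂, χ₁ + χ₂)`: on the good set `M_N` and `Sraw_N`
are additive in the tests, so `{δ < |M − Sraw|} ⊆ goodᶜ ∪ {δ/2 < |M₁ − Sraw₁|} ∪ {δ/2 < |M₂ − Sraw₂|}` for
every `τ`, and the bad set is null (`localGibbsLaw_compl_good'`). [folklore] -/
theorem fluxFormChaos_add' (hψ₁ : Torus.IsSmoothSpaceTimeOn (Icc 0 t) ψ₁)
    (hψ₂ : Torus.IsSmoothSpaceTimeOn (Icc 0 t) ψ₂) (hχ₁ : Torus.IsSmoothSpaceTimeOn (Icc 0 t) χ₁)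
    (hχ₂ : Torus.IsSmoothSpaceTimeOn (Icc 0 t) χ₂) (h₁ : FluxFormChaos σ a₀ θ₀ u₀ Φ φ t ψ₁ χ₁)
    (h₂ : FluxFormChaos σ a₀ θ₀ u₀ Φ φ t ψ₂ χ₂) :
    FluxFormChaos σ a₀ θ₀ u₀ Φ φ t (ψ₁ + ψ₂) (χ₁ + χ₂) := by
  intro δ hδ
  have hδ2 : 0 < δ / 2 := half_pos hδ
  have hsum := (h₁ (δ / 2) hδ2).add (h₂ (δ / 2) hδ2)
  rw [add_zero] at hsum
  refine tendsto_of_tendsto_of_tendsto_of_le_of_le tendsto_const_nhds hsum (fun N => bot_le) fun N => ?_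
  set P : Measure (Cfg N) := localGibbsLaw σ a₀ u₀ θ₀ N (Φ N) with hP
  set A₁ : Set (Cfg N) := {z | ∃ τ ∈ Icc 0 t, δ / 2 < |Mfun σ Φ ψ₁ χ₁ N z τ - Sraw σ Φ φ ψ₁ χ₁ N z τ|}
  set A₂ : Set (Cfg N) := {z | ∃ τ ∈ Icc 0 t, δ / 2 < |Mfun σ Φ ψ₂ χ₂ N z τ - Sraw σ Φ φ ψ₂ χ₂ N z τ|}
  have hcover : {z : Cfg N | ∃ τ ∈ Icc 0 t, δ < |Mfun σ Φ (ψ₁ + ψ₂) (χ₁ + χ₂) N z τ -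
      Sraw σ Φ φ (ψ₁ + ψ₂) (χ₁ + χ₂) N z τ|} ⊆ (Φ N).goodᶜ ∪ (A₁ ∪ A₂) := by
    rintro z ⟨τ, hτ, hzδ⟩
    by_cases hz : z ∈ (Φ N).good
    · right
      have hsl : ∀ {u : ℝ → T3 → V3}, Torus.IsSmoothSpaceTimeOn (Icc 0 t) u →
          ∀ s ∈ Ioc 0 τ, Torus.IsSmooth (u s) :=
        fun hu s hs => hu.isSmooth_slice ⟨hs.1.le, hs.2.trans hτ.2⟩
      have hsl' : ∀ {u : ℝ → T3 → ℝ}, Torus.IsSmoothSpaceTimeOn (Icc 0 t) u →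
          ∀ s ∈ Ioc 0 τ, Torus.IsSmooth (u s) :=
        fun hu s hs => hu.isSmooth_slice ⟨hs.1.le, hs.2.trans hτ.2⟩
      rw [Mfun_add Φ hz (hsl hψ₁) (hsl hψ₂) (hsl' hχ₁) (hsl' hχ₂),
        Sraw_add Φ hz (hsl hψ₁) (hsl hψ₂) (hsl' hχ₁) (hsl' hχ₂)] at hzδ
      by_contra hno
      simp only [Set.mem_union, Set.mem_setOf_eq, not_or, not_exists, not_and, not_lt, A₁, A₂] at hno
      have e₁ := hno.1 τ hτ
      have e₂ := hno.2 τ hτ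
      have htri := abs_add_le (Mfun σ Φ ψ₁ χ₁ N z τ - Sraw σ Φ φ ψ₁ χ₁ N z τ)
        (Mfun σ Φ ψ₂ χ₂ N z τ - Sraw σ Φ φ ψ₂ χ₂ N z τ)
      have hre : Mfun σ Φ ψ₁ χ₁ N z τ + Mfun σ Φ ψ₂ χ₂ N z τ -
          (Sraw σ Φ φ ψ₁ χ₁ N z τ + Sraw σ Φ φ ψ₂ χ₂ N z τ) =
          (Mfun σ Φ ψ₁ χ₁ N z τ - Sraw σ Φ φ ψ₁ χ₁ N z τ) +
            (Mfun σ Φ ψ₂ χ₂ N z τ - Sraw σ Φ φ ψ₂ χ₂ N z τ) := by ring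
      rw [hre] at hzδ
      linarith
    · exact Or.inl hz
  calc P {z : Cfg N | ∃ τ ∈ Icc 0 t, δ < |Mfun σ Φ (ψ₁ + ψ₂) (χ₁ + χ₂) N z τ -
        Sraw σ Φ φ (ψ₁ + ψ₂) (χ₁ + χ₂) N z τ|}
      ≤ P ((Φ N).goodᶜ ∪ (A₁ ∪ A₂)) := measure_mono hcover
    _ ≤ P (Φ N).goodᶜ + P (A₁ ∪ A₂) := measure_union_le _ _
    _ = P (A₁ ∪ A₂) := by rw [hP, localGibbsLaw_compl_good' (Φ N), zero_add]
    _ ≤ P A₁ + P A₂ := measure_union_le _ _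

/-- **Registered helper `fluxFormChaos_add` — [A'-chaos] is ADDITIVE in the test pair** (audit helper for
`stub_fluxFormChaosE`, worker W-A of lead c4): for jointly smooth `ψ₁, ψ₂, χ₁, χ₂` on `[0, t]`, `FluxFormChaos` at
`(ψ₁, χ₁)` and at `(ψ₂, χ₂)` gives it at `(ψ₁ + ψ₂, χ₁ + χ₂)` (`M_N`, `Sraw_N` additive on the good set, union bound, null
bad set). With `fluxFormChaos_smul` the smooth test pairs satisfying [A'-chaos] form a linear subspace, and the
stub reduces to the pure cases `(ψ, 0)`, `(0, χ)` (`fluxFormChaos_of_split`). [folklore] -/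
theorem fluxFormChaos_add : ∀ {σ : ℝ} {a₀ θ₀ : T3 → ℝ} {u₀ : T3 → V3} {Φ : Flows σ} {φ : ℕ → T3 → ℝ} {t : ℝ} {ψ₁ ψ₂ : ℝ → T3 → V3} {χ₁ χ₂ : ℝ → T3 → ℝ}, Literature.Analysis.FunctionSpaces.Torus.IsSmoothSpaceTimeOn (Icc 0 t) ψ₁ → Literature.Analysis.FunctionSpaces.Torus.IsSmoothSpaceTimeOn (Icc 0 t) ψ₂ → Literature.Analysis.FunctionSpaces.Torus.IsSmoothSpaceTimeOn (Icc 0 t) χ₁ → Literature.Analysis.FunctionSpaces.Torus.IsSmoothSpaceTimeOn (Icc 0 t) χ₂ → FluxFormChaos σ a₀ θ₀ u₀ Φ φ t ψ₁ χ₁ → FluxFormChaos σ a₀ θ₀ u₀ Φ φ t ψ₂ χ₂ → FluxFormChaos σ a₀ θ₀ u₀ Φ φ t (ψ₁ + ψ₂) (χ₁ + χ₂) :=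
  fun hψ₁ hψ₂ hχ₁ hχ₂ h₁ h₂ => fluxFormChaos_add' hψ₁ hψ₂ hχ₁ hχ₂ h₁ h₂

/-- **[A'-chaos] is HOMOGENEOUS in the test pair**: `FluxFormChaos` at `(ψ, χ)` (jointly smooth on `[0, t]`)
gives it at `(c ψ, c χ)` for every real `c`. [folklore] -/
theorem fluxFormChaos_smul (hψ : Torus.IsSmoothSpaceTimeOn (Icc 0 t) ψ) (hχ : Torus.IsSmoothSpaceTimeOn (Icc 0 t) χ)
    (h : FluxFormChaos σ a₀ θ₀ u₀ Φ φ t ψ χ) (c : ℝ) :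
    FluxFormChaos σ a₀ θ₀ u₀ Φ φ t (c • ψ) (c • χ) := by
  intro δ hδ
  by_cases hc : c = 0
  · -- the sums vanish on the good set
    refine tendsto_of_tendsto_of_tendsto_of_le_of_le tendsto_const_nhds tendsto_const_nhds (fun N => bot_le)
      fun N => ?_
    have hcover : {z : Cfg N | ∃ τ ∈ Icc 0 t, δ < |Mfun σ Φ (c • ψ) (c • χ) N z τ -
        Sraw σ Φ φ (c • ψ) (c • χ) N z τ|} ⊆ (Φ N).goodᶜ := by
      rintro z ⟨τ, hτ, hzδ⟩ hz
      have hs : ∀ s ∈ Ioc 0 τ, Torus.IsSmooth (ψ s) := fun s hs => hψ.isSmooth_slice ⟨hs.1.le, hs.2.trans hτ.2⟩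
      have hs' : ∀ s ∈ Ioc 0 τ, Torus.IsSmooth (χ s) := fun s hs => hχ.isSmooth_slice ⟨hs.1.le, hs.2.trans hτ.2⟩
      rw [Mfun_smul Φ hz hs hs', Sraw_smul Φ hz hs hs', hc] at hzδ
      simp at hzδ
      linarith
    calc localGibbsLaw σ a₀ u₀ θ₀ N (Φ N) {z : Cfg N | ∃ τ ∈ Icc 0 t, δ < |Mfun σ Φ (c • ψ) (c • χ) N z τ -
          Sraw σ Φ φ (c • ψ) (c • χ) N z τ|} ≤ localGibbsLaw σ a₀ u₀ θ₀ N (Φ N) (Φ N).goodᶜ := measure_mono hcover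
      _ = 0 := localGibbsLaw_compl_good' (Φ N)
  · have hcpos : 0 < |c| := abs_pos.2 hc
    have hδ' : 0 < δ / |c| := div_pos hδ hcpos
    refine tendsto_of_tendsto_of_tendsto_of_le_of_le tendsto_const_nhds (h (δ / |c|) hδ') (fun N => bot_le)
      fun N => ?_
    have hcover : {z : Cfg N | ∃ τ ∈ Icc 0 t, δ < |Mfun σ Φ (c • ψ) (c • χ) N z τ -
        Sraw σ Φ φ (c • ψ) (c • χ) N z τ|} ⊆
        (Φ N).goodᶜ ∪ {z | ∃ τ ∈ Icc 0 t, δ / |c| < |Mfun σ Φ ψ χ N z τ - Sraw σ Φ φ ψ χ N z τ|} := by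
      rintro z ⟨τ, hτ, hzδ⟩
      by_cases hz : z ∈ (Φ N).good
      · right
        have hs : ∀ s ∈ Ioc 0 τ, Torus.IsSmooth (ψ s) := fun s hs => hψ.isSmooth_slice ⟨hs.1.le, hs.2.trans hτ.2⟩
        have hs' : ∀ s ∈ Ioc 0 τ, Torus.IsSmooth (χ s) := fun s hs => hχ.isSmooth_slice ⟨hs.1.le, hs.2.trans hτ.2⟩
        rw [Mfun_smul Φ hz hs hs', Sraw_smul Φ hz hs hs', ← mul_sub, abs_mul] at hzδ
        refine ⟨τ, hτ, ?_⟩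
        rw [div_lt_iff₀ hcpos, mul_comm]
        exact hzδ
      · exact Or.inl hz
    calc localGibbsLaw σ a₀ u₀ θ₀ N (Φ N) {z : Cfg N | ∃ τ ∈ Icc 0 t, δ < |Mfun σ Φ (c • ψ) (c • χ) N z τ -
          Sraw σ Φ φ (c • ψ) (c • χ) N z τ|}
        ≤ localGibbsLaw σ a₀ u₀ θ₀ N (Φ N) ((Φ N).goodᶜ ∪
            {z | ∃ τ ∈ Icc 0 t, δ / |c| < |Mfun σ Φ ψ χ N z τ - Sraw σ Φ φ ψ χ N z τ|}) := measure_mono hcover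
      _ ≤ localGibbsLaw σ a₀ u₀ θ₀ N (Φ N) (Φ N).goodᶜ + localGibbsLaw σ a₀ u₀ θ₀ N (Φ N)
            {z | ∃ τ ∈ Icc 0 t, δ / |c| < |Mfun σ Φ ψ χ N z τ - Sraw σ Φ φ ψ χ N z τ|} := measure_union_le _ _
      _ = _ := by rw [localGibbsLaw_compl_good' (Φ N), zero_add]

/-- The zero tests are jointly smooth. [folklore] -/
private theorem isSmoothSpaceTimeOn_zero {F' : Type*} [NormedAddCommGroup F'] [NormedSpace ℝ F'] (S : Set ℝ) :
    Torus.IsSmoothSpaceTimeOn S (0 : ℝ → T3 → F') :=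
  Torus.isSmoothSpaceTimeOn_const (Torus.isContDiff_const (0 : F')) S

/-- **The two Hoeffding projections decouple: [A'-chaos] reduces to the pure cases `(ψ, 0)` and `(0, χ)`.**
For jointly smooth `ψ`, `χ` on `[0, t]`, `FluxFormChaos` at `(ψ, 0)` (the `ω⊗ω:∇ψ` mark alone) and at `(0, χ)`
(the `(V·ω)(ω·∇χ)` mark alone) give it at `(ψ, χ)`. [folklore] -/
theorem fluxFormChaos_of_split (hψ : Torus.IsSmoothSpaceTimeOn (Icc 0 t) ψ) (hχ : Torus.IsSmoothSpaceTimeOn (Icc 0 t) χ)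
    (h₁ : FluxFormChaos σ a₀ θ₀ u₀ Φ φ t ψ (0 : ℝ → T3 → ℝ))
    (h₂ : FluxFormChaos σ a₀ θ₀ u₀ Φ φ t (0 : ℝ → T3 → V3) χ) : FluxFormChaos σ a₀ θ₀ u₀ Φ φ t ψ χ := by
  have h := fluxFormChaos_add' hψ (isSmoothSpaceTimeOn_zero _) (isSmoothSpaceTimeOn_zero _) hχ h₁ h₂
  simpa only [add_zero, zero_add] using h

end FluxFormChaosLinear

end

end Summit.AtomisticToContinuum.HydrodynamicLimit.Theorems.HemisphereAffineSlaving
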